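import Literature.Analysis.FluidPDE.EyinkUniformDefect
import HarnessLib

/-!
# Uniform Eyink defects are Duchon–Robert defects: consistency and the reduction of the 4/5-law fact

Topic: Analysis/FluidPDE, a complement to `Literature.Analysis.FluidPDE.EyinkUniformDefect`
(the notion `Torus.HasUniformEyinkDefect T u D` — Eyink's mollified fluxes `D_L^{ε,φ}(u)`,
`D_T^{ε,φ}(u)` converge to `D` uniformly over spherically symmetric unit-ball mollifiers — and its
main theorem `HasUniformEyinkDefect.hasFourFifthsLaw`, the *unconditional* local 4/5 law for such
`D`). Everything here is proved.

## Why this file exists (the named fact `HasDuchonRobertDefect.hasFourFifthsLaw`)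

The accepted fact `Torus.HasDuchonRobertDefect.hasFourFifthsLaw` (`DissipationAnomaly`) concludes
`Torus.HasFourFifthsLaw T u D` for **the** Duchon–Robert defect `D` of an `L³` weak Euler solution
(`Torus.HasDuchonRobertDefect T u D`: `∫₀ᵀ∫ D_ε^φ(u) ψ → D ψ` for every mollifier `φ`).
`EyinkUniformDefect` proves the law for a functional `D'` that is a *uniform Eyink defect* of `u`;
to feed the accepted fact one must know that such a `D'` agrees with `D` on test functions. This
file supplies that identification without any further appeal to the Euler equation:

* `Torus.energyFluxShellPairing_eq_add` — the shell pairing of the 4/3 law splits into the two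
  shell pairings of Eyink's Cor. 1, `I(r) = I_L(r) + I_T(r)` (`⟨δu_L|δu|²⟩_{ang} = ⟨(δu_L)³⟩_{ang} +
  ⟨δu_L|δu_T|²⟩_{ang}`, Pythagoras on the unit sphere; the sphere integrands are integrable for a.e.
  `(t,x)`).
* `Torus.HasUniformEyinkDefect.tendsto_duchonRobertApprox` — for a spherically symmetric unit-ball
  mollifier `φ` and `ε > 0`, at the level of `ψ`-pairings
  `D_ε^φ(u) = d⁻¹ D_L^{ε,φ}(u) + ((d−1)/d) D_T^{ε,φ}(u)` (the radial formulas
  `Torus.integral_duchonRobertApprox_eq_radial`, `Torus.integral_eyinkApprox_eq` and `I = I_L + I_T`;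
  this is the integrated form of `u^ε = u_L^ε + u_T^ε`, `u_L^ε → u/d`, `u_T^ε → (d−1)u/d` in Eyink
  2003, proof of Thm. 1), hence `∫₀ᵀ∫ D_ε^φ(u) ψ → D ψ` as `ε → 0⁺` (`d ≥ 2`).
* `Torus.HasUniformEyinkDefect.eq_of_hasDuchonRobertDefect` — consequently a uniform Eyink defect
  `D'` of a field with Duchon–Robert defect `D` satisfies `D' ψ = D ψ` on test functions supported in
  `(0,T)` (uniqueness of limits for one radial mollifier, `Torus.exists_isMollifier_radial`).
* The glue towards the fact: `Torus.HasFourFifthsLaw.congr_defect`,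
  `Torus.HasDuchonRobertDefect.hasFourFifthsLaw_of_hasUniformEyinkDefect` and the **reduction**
  `Torus.hasFourFifthsLaw_of_forall_hasUniformEyinkDefect`: in dimension `d ≥ 2` the accepted fact
  `HasDuchonRobertDefect.hasFourFifthsLaw` follows as soon as every `L³` weak Euler solution with a
  Duchon–Robert defect admits *some* uniform Eyink defect — the remaining, Euler-dependent input
  (Eyink 2003, proof of Thm. 1: the balance identities (uuL-eq), (uuT-eq) at scale `ε` and the
  uniform bounds (norm-uL-thirdu), (norm-pT-twothirdp), with the `L^{3/2}` pressure of
  `Torus.exists_pressure_of_tendsto_L3`).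
* `Torus.HasUniformEyinkDefect.tendsto_fin_three` — the printed constants `−4/5`, `−8/15` in `d = 3`.

## Design notes

* Dimension `d ≥ 2` throughout, as in `EyinkUniformDefect` (the `1/|ξ|` kernel inside `D_L^ε`,
  `D_T^ε` is locally integrable only for `d ≥ 2`); `d ≤ 1` is degenerate for the accepted fact and
  not treated here.
* The identity `D_ε^φ = d⁻¹ D_L^{ε,φ} + ((d−1)/d) D_T^{ε,φ}` is proved for the `ψ`-pairings and
  spherically symmetric unit-ball `φ` only (through the polar formulas), which is all the
  identification needs; no claim is made for non-radial mollifiers.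

## References

* G. L. Eyink, *Local 4/5-law and energy dissipation anomaly in turbulence*, Nonlinearity 16 (2003)
  137–145 = arXiv:nlin/0208004: §2, proof of Thm. 1 (`u_L^ε + u_T^ε = u^ε`, `u_L^ε → u/3`,
  `u_T^ε → 2u/3`), Cor. 1 and its proof. [Eyink2003]
* J. Duchon, R. Robert, *Inertial energy dissipation for weak solutions of incompressible Euler and
  Navier–Stokes equations*, Nonlinearity 13 (2000) 249–255: Prop. 2 (the defect and its
  independence of `φ`). [DuchonRobert2000]
-/

noncomputable section

open MeasureTheory MeasureTheory.Measure TopologicalSpace Set Function Filter Topology Metric Module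
open scoped InnerProductSpace RealInnerProductSpace ENNReal NNReal

namespace Literature.Analysis.FluidPDE.Torus

variable {d : Type*} [Fintype d]

/-! ## The energy-flux shell pairing splits into Eyink's two shell pairings -/

section Split

variable {T : ℝ} {u : ℝ → UnitAddTorus d → EuclideanSpace ℝ d} {ψ : ℝ → UnitAddTorus d → ℝ} {Cψ : ℝ}

/-- Pythagoras inside the cubic forms: for a **unit** vector `ω`,
`⟪v,ω⟫|v|² = ⟪v,ω⟫³ + ⟪v,ω⟫|v − ⟪v,ω⟫ω|²` (`δu_L|δu|² = (δu_L)³ + δu_L|δu_T|²`, Eyink 2003,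
proof of Cor. 1; cf. `Torus.cubicFormT_eq`). [cite: Eyink2003, §2 Cor. 1] -/
theorem inner_mul_norm_sq_eq_cubicForms {ω : EuclideanSpace ℝ d} (hω : ‖ω‖ = 1) (v : EuclideanSpace ℝ d) :
    ⟪v, ω⟫ * ‖v‖ ^ 2 = ⟪v, ω⟫ ^ 3 + ⟪v, ω⟫ * ‖v - ⟪v, ω⟫ • ω‖ ^ 2 := by
  rw [cubicFormT_eq, hω]
  ring

/-- **The energy-flux shell pairing splits**: `I(r) = I_L(r) + I_T(r)` for every scale `r`, where
`I = Torus.energyFluxShellPairing T u ψ` (inside the 4/3 law) and `I_L`, `I_T` are the cubic shell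
pairings of `Q_L(ω,v) = ⟪v,ω⟫³`, `Q_T(ω,v) = ⟪v,ω⟫|v − ⟪v,ω⟫ω|²` (inside Eyink's `S_L`, `S_T`):
`⟨δu_L|δu|²⟩_{ang} = ⟨(δu_L)³⟩_{ang} + ⟨δu_L|δu_T|²⟩_{ang}` for a.e. `(t,x)` (where the three sphere
integrands are integrable), and the product-measure pairings agree. [folklore] -/
theorem energyFluxShellPairing_eq_add [Nonempty d]
    (hu : AEStronglyMeasurable (uncurry u) ((volume.restrict (Ioo 0 T)).prod volume))
    (hu3 : ∫⁻ p, ‖uncurry u p‖ₑ ^ 3 ∂((volume.restrict (Ioo 0 T)).prod volume) < ∞)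
    (hψm : AEStronglyMeasurable (uncurry ψ) ((volume.restrict (Ioo 0 T)).prod volume))
    (hψb : ∀ t x, |ψ t x| ≤ Cψ) (r : ℝ) :
    energyFluxShellPairing T u ψ r =
      cubicShellPairing (fun (ω v : EuclideanSpace ℝ d) => ⟪v, ω⟫ ^ 3) T u ψ r +
        cubicShellPairing (fun (ω v : EuclideanSpace ℝ d) => ⟪v, ω⟫ * ‖v - ⟪v, ω⟫ • ω‖ ^ 2) T u ψ r := by
  set μp : Measure (ℝ × UnitAddTorus d) := (volume.restrict (Ioo 0 T)).prod volume with hμp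
  set σ : Measure ↥(sphere (0 : EuclideanSpace ℝ d) 1) := volume.toSphere with hσ
  set c : ℝ := (volume : Measure (EuclideanSpace ℝ d)).toSphere.real univ with hcdef
  have hc : 0 < c := toSphere_real_univ_pos
  -- the three cubic forms
  set Q : EuclideanSpace ℝ d → EuclideanSpace ℝ d → ℝ := fun ω v => ⟪v, ω⟫ * ‖v‖ ^ 2 with hQdef
  set QL : EuclideanSpace ℝ d → EuclideanSpace ℝ d → ℝ := fun ω v => ⟪v, ω⟫ ^ 3 with hQLdef
  set QT : EuclideanSpace ℝ d → EuclideanSpace ℝ d → ℝ := fun ω v => ⟪v, ω⟫ * ‖v - ⟪v, ω⟫ • ω‖ ^ 2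
    with hQTdef
  have hQc : Continuous (uncurry Q) :=
    (continuous_snd.inner continuous_fst).mul (continuous_snd.norm.pow 2)
  have hQ : ∀ ω v, ‖ω‖ ≤ 1 → |Q ω v| ≤ 1 * ‖v‖ ^ 3 := fun ω v hω => by
    rw [one_mul, hQdef, abs_mul, abs_of_nonneg (pow_nonneg (norm_nonneg v) 2)]
    calc |⟪v, ω⟫| * ‖v‖ ^ 2 ≤ ‖v‖ * ‖ω‖ * ‖v‖ ^ 2 := by
          gcongr; exact abs_real_inner_le_norm v ω
      _ ≤ ‖v‖ * 1 * ‖v‖ ^ 2 := by gcongr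
      _ = ‖v‖ ^ 3 := by ring
  have hQLc : Continuous (uncurry QL) := continuous_cubicFormL
  have hQL : ∀ ω v, ‖ω‖ ≤ 1 → |QL ω v| ≤ 1 * ‖v‖ ^ 3 := fun _ v hω => abs_cubicFormL_le v hω
  have hQTc : Continuous (uncurry QT) := continuous_cubicFormT
  have hQT : ∀ ω v, ‖ω‖ ≤ 1 → |QT ω v| ≤ 4 * ‖v‖ ^ 3 := fun _ v hω => abs_cubicFormT_le v hω
  -- integrability on `((0,T) × T^d) × S^{d-1}` of the three integrands
  have hIL := integrable_sphere_increment hu hu3 hψm hψb hQLc zero_le_one hQL r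
  have hIT := integrable_sphere_increment hu hu3 hψm hψb hQTc (by norm_num) hQT r
  -- the inner integrals are `c` times the sphere averages
  have hinner : ∀ (F : EuclideanSpace ℝ d → EuclideanSpace ℝ d → ℝ) (p : ℝ × UnitAddTorus d),
      ∫ ω : sphere (0 : EuclideanSpace ℝ d) 1,
          F ω (increment (u p.1) (r • (ω : EuclideanSpace ℝ d)) p.2) * ψ p.1 p.2 ∂σ =
        c * (sphereAvg (fun y => F y (increment (u p.1) (r • y) p.2)) * ψ p.1 p.2) := fun F p => by
    rw [integral_mul_const,
      integral_sphere_eq_mul_sphereAvg (fun y => F y (increment (u p.1) (r • y) p.2)), mul_assoc]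
  -- a.e. splitting of the sphere averages
  have hae : ∀ᵐ p : ℝ × UnitAddTorus d ∂μp,
      c * (sphereAvg (fun y => Q y (increment (u p.1) (r • y) p.2)) * ψ p.1 p.2) =
        c * (sphereAvg (fun y => QL y (increment (u p.1) (r • y) p.2)) * ψ p.1 p.2) +
          c * (sphereAvg (fun y => QT y (increment (u p.1) (r • y) p.2)) * ψ p.1 p.2) := by
    filter_upwards [hIL.prod_right_ae, hIT.prod_right_ae] with p hL hT
    have hL' : Integrable (fun ω : sphere (0 : EuclideanSpace ℝ d) 1 =>
        QL ω (increment (u p.1) (r • (ω : EuclideanSpace ℝ d)) p.2) * ψ p.1 p.2) σ := hL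
    have hT' : Integrable (fun ω : sphere (0 : EuclideanSpace ℝ d) 1 =>
        QT ω (increment (u p.1) (r • (ω : EuclideanSpace ℝ d)) p.2) * ψ p.1 p.2) σ := hT
    rw [← hinner Q p, ← hinner QL p, ← hinner QT p, ← integral_add hL' hT']
    refine integral_congr_ae (ae_of_all _ fun ω => ?_)
    have hω : ‖(ω : EuclideanSpace ℝ d)‖ = 1 := norm_eq_of_mem_sphere ω
    simp only [hQdef, hQLdef, hQTdef]
    rw [inner_mul_norm_sq_eq_cubicForms hω, add_mul]
  -- integrate
  have hmL : Integrable (fun p : ℝ × UnitAddTorus d =>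
      c * (sphereAvg (fun y => QL y (increment (u p.1) (r • y) p.2)) * ψ p.1 p.2)) μp :=
    hIL.integral_prod_left.congr (ae_of_all _ fun p => hinner QL p)
  have hmT : Integrable (fun p : ℝ × UnitAddTorus d =>
      c * (sphereAvg (fun y => QT y (increment (u p.1) (r • y) p.2)) * ψ p.1 p.2)) μp :=
    hIT.integral_prod_left.congr (ae_of_all _ fun p => hinner QT p)
  have e1 : c * energyFluxShellPairing T u ψ r =
      c * cubicShellPairing QL T u ψ r + c * cubicShellPairing QT T u ψ r := by
    rw [energyFluxShellPairing, cubicShellPairing, cubicShellPairing, ← hμp,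
      ← integral_const_mul, ← integral_const_mul, ← integral_const_mul, ← integral_add hmL hmT]
    exact integral_congr_ae hae
  have := congrArg (fun z => c⁻¹ * z) e1
  simp only [mul_add, ← mul_assoc, inv_mul_cancel₀ hc.ne', one_mul] at this
  exact this

end Split

/-! ## Uniform Eyink defects reproduce the Duchon–Robert pairings -/

section Consistency

variable {T : ℝ} {u : ℝ → UnitAddTorus d → EuclideanSpace ℝ d} {D D' : STFunctional d}
  {ψ : ℝ → UnitAddTorus d → ℝ}

/-- Integrability on `(0,∞)` of the rescaled shell integrands `x ↦ x^{m+1} X(x) (εx)⁻¹ I(εx)` for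
continuous `I`, `X` with `X` vanishing on `(1,∞)` and `ε > 0` (on `(0,1]` the integrand is the
continuous `ε⁻¹ x^m X(x) I(εx)`). [folklore] -/
theorem integrableOn_pow_mul_mul_shellFunction {X I : ℝ → ℝ} (hX : Continuous X)
    (hXsupp : ∀ x, 1 < x → X x = 0) (hI : Continuous I) (m : ℕ) {ε : ℝ} (hε : 0 < ε) :
    IntegrableOn (fun x : ℝ => x ^ (m + 1) * X x * ((ε * x)⁻¹ * I (ε * x))) (Ioi 0) := by
  have hg : Continuous fun x : ℝ => ε⁻¹ * (x ^ m * X x * I (ε * x)) :=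
    continuous_const.mul ((((continuous_pow m).mul hX)).mul (hI.comp (continuous_const.mul continuous_id)))
  have h1 : IntegrableOn (fun x : ℝ => x ^ (m + 1) * X x * ((ε * x)⁻¹ * I (ε * x))) (Ioc 0 1) := by
    refine ((hg.integrableOn_Icc (a := 0) (b := 1)).mono_set Ioc_subset_Icc_self).congr_fun
      (fun x hx => ?_) measurableSet_Ioc
    have hx0 : (0 : ℝ) < x := hx.1
    rw [pow_succ]
    field_simp
  refine h1.of_forall_sdiff_eq_zero measurableSet_Ioi fun x hx => ?_
  have hx1 : 1 < x := by
    have h0 : 0 < x := hx.1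
    by_contra h
    exact hx.2 ⟨h0, not_lt.1 h⟩
  rw [hXsupp x hx1, mul_zero, zero_mul]

/-- **Uniform Eyink defects reproduce the Duchon–Robert pairings** (`d ≥ 2`): for a spherically
symmetric unit-ball mollifier `φ`, `∫₀ᵀ∫ D_ε^φ(u) ψ → D ψ` as `ε → 0⁺`. Indeed, for `ε > 0`,
`∫∫ D_ε^φ ψ = d⁻¹ ∫∫ D_L^{ε,φ} ψ + ((d−1)/d) ∫∫ D_T^{ε,φ} ψ` by the radial formulas
(`integral_duchonRobertApprox_eq_radial`: `¼|S|∫ x^dΦ' G(εx)`; `integral_eyinkApprox_eq`: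
`(d/4)|S|(∫ x^dΦ' G_L(εx) + J₂)`, `(d/(4(d−1)))|S|(∫ x^dΦ' G_T(εx) − J₂)`) and `G = G_L + G_T`
(`energyFluxShellPairing_eq_add`) — the integrated form of `u^ε = u_L^ε + u_T^ε`,
`u_L^ε → u/d`, `u_T^ε → (d−1)u/d` (Eyink 2003, proof of Thm. 1, with `1/3`, `2/3` in `d = 3`). [folklore] -/
theorem HasUniformEyinkDefect.tendsto_duchonRobertApprox (h : HasUniformEyinkDefect T u D)
    (hn2 : 2 ≤ Fintype.card d)
    (hum : AEStronglyMeasurable (FunctionSpaces.Torus.stLift u) (volume.restrict (Ioo 0 T ×ˢ univ)))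
    (hu3 : ∫⁻ t in Ioo 0 T, ∫⁻ x, ‖u t x‖ₑ ^ (3 : ℕ) < ∞)
    {φ : EuclideanSpace ℝ d → ℝ} (hφ : IsRadialUnitBallMollifier φ)
    (hψ : FunctionSpaces.Torus.IsSpaceTimeTestIoo T ψ) :
    Tendsto (fun ε => ∫ t in Ioo 0 T, ∫ x, duchonRobertApprox φ ε (u t) x * ψ t x) (𝓝[>] 0)
      (𝓝 (D ψ)) := by
  haveI : Nonempty d := by
    by_contra hd
    rw [not_nonempty_iff] at hd
    have : Fintype.card d = 0 := Fintype.card_eq_zero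
    omega
  set μp : Measure (ℝ × UnitAddTorus d) := (volume.restrict (Ioo 0 T)).prod volume with hμp
  have hu : AEStronglyMeasurable (uncurry u) μp := aestronglyMeasurable_uncurry_prod_of_stLift_Ioo hum
  have hu3' : ∫⁻ p, ‖uncurry u p‖ₑ ^ 3 ∂μp < ∞ := lintegral_prod_enorm_pow_three_lt_top hu hu3
  have hψm : AEStronglyMeasurable (uncurry ψ) μp := hψ.continuous_uncurry.aestronglyMeasurable
  obtain ⟨Cψ, hψb⟩ := hψ.exists_abs_le
  obtain ⟨m, hnm⟩ : ∃ m : ℕ, Fintype.card d = m + 2 := ⟨Fintype.card d - 2, by omega⟩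
  set n : ℕ := Fintype.card d with hndef
  have hn0 : (0 : ℝ) < n := by rw [hnm]; positivity
  have hnR : (n : ℝ) = (m : ℝ) + 2 := by rw [hnm]; push_cast; ring
  set c : ℝ := (volume : Measure (EuclideanSpace ℝ d)).toSphere.real univ with hcdef
  have hc : 0 < c := toSphere_real_univ_pos
  obtain ⟨e₀, he₀⟩ : ∃ e : EuclideanSpace ℝ d, ‖e‖ = 1 := by
    classical
    obtain ⟨i⟩ := ‹Nonempty d›
    exact ⟨EuclideanSpace.single i 1, by simp⟩
  -- the two shell pairings and shell functions
  set IL : ℝ → ℝ := cubicShellPairing (fun (ω v : EuclideanSpace ℝ d) => ⟪v, ω⟫ ^ 3) T u ψ with hILdef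
  set IT : ℝ → ℝ := cubicShellPairing
    (fun (ω v : EuclideanSpace ℝ d) => ⟪v, ω⟫ * ‖v - ⟪v, ω⟫ • ω‖ ^ 2) T u ψ with hITdef
  have hILc : Continuous IL := continuous_cubicShellPairing_L hu hu3' hψm hψb
  have hITc : Continuous IT := continuous_cubicShellPairing_T hu hu3' hψm hψb
  set gL : ℝ → ℝ := fun r => r⁻¹ * IL r with hgLdef
  set gT : ℝ → ℝ := fun r => r⁻¹ * IT r with hgTdef
  -- the profile of `φ`
  set Φ : ℝ → ℝ := fun r => φ (r • e₀) with hΦ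
  have hΦ1 : ContDiff ℝ 1 Φ := (hφ.1.1.1.of_le (by simp)).comp (contDiff_id.smul contDiff_const)
  have hΦsupp : ∀ r, 1 < r → Φ r = 0 := fun r hr =>
    hφ.1.2 _ (by rw [norm_smul, he₀, mul_one, Real.norm_eq_abs]; exact hr.trans_le (le_abs_self r))
  have hΦ'supp : ∀ r, 1 < r → deriv Φ r = 0 := fun r hr => deriv_eq_zero_of_forall_gt hΦsupp hr
  have hΦ'c : Continuous (deriv Φ) := hΦ1.continuous_deriv le_rfl
  -- the identity `D_ε = d⁻¹ D_L^ε + ((d-1)/d) D_T^ε` on `ψ`-pairings, for `ε > 0`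
  have hid : ∀ ε, 0 < ε → ∫ t in Ioo 0 T, ∫ x, duchonRobertApprox φ ε (u t) x * ψ t x =
      (n : ℝ)⁻¹ * (∫ t in Ioo 0 T, ∫ x, eyinkLongitudinalApprox φ ε (u t) x * ψ t x) +
        ((n : ℝ) - 1) / n * (∫ t in Ioo 0 T, ∫ x, eyinkTransverseApprox φ ε (u t) x * ψ t x) := by
    intro ε hε
    have e1 : ∫ t in Ioo 0 T, ∫ x, duchonRobertApprox φ ε (u t) x * ψ t x =
        4⁻¹ * c * ∫ x in Ioi (0 : ℝ), x ^ n * deriv Φ x *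
          ((ε * x)⁻¹ * energyFluxShellPairing T u ψ (ε * x)) :=
      integral_duchonRobertApprox_eq_radial (T := T) (u := u) (ψ := ψ) hφ.1 hφ.2 he₀ hu hu3' hψm hψb hε
    have e2 := integral_eyinkApprox_eq (T := T) (u := u) (ψ := ψ) hn2 hφ.1.1 hφ.2 hφ.1.2 he₀ hu hu3'
      hψm hψb hε
    have e2L : ∫ t in Ioo 0 T, ∫ x, eyinkLongitudinalApprox φ ε (u t) x * ψ t x =
        eyinkLongitudinalConst d * c *
          ((∫ x in Ioi (0 : ℝ), x ^ n * deriv Φ x * gL (ε * x)) +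
            ∫ x in Ioi (0 : ℝ), 2 * x ^ (n - 1) * Φ x * gT (ε * x)) := e2.1
    have e2T : ∫ t in Ioo 0 T, ∫ x, eyinkTransverseApprox φ ε (u t) x * ψ t x =
        eyinkTransverseConst d * c *
          ((∫ x in Ioi (0 : ℝ), x ^ n * deriv Φ x * gT (ε * x)) -
            ∫ x in Ioi (0 : ℝ), 2 * x ^ (n - 1) * Φ x * gT (ε * x)) := e2.2
    -- the Duchon–Robert integrand splits
    have hsum : ∀ x : ℝ, (ε * x)⁻¹ * energyFluxShellPairing T u ψ (ε * x) = gL (ε * x) + gT (ε * x) := by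
      intro x
      simp only [hgLdef, hgTdef, hILdef, hITdef]
      rw [energyFluxShellPairing_eq_add hu hu3' hψm hψb, mul_add]
    have hintL : IntegrableOn (fun x : ℝ => x ^ n * deriv Φ x * gL (ε * x)) (Ioi 0) := by
      have := integrableOn_pow_mul_mul_shellFunction hΦ'c hΦ'supp hILc (m + 1) hε
      rw [← hnm] at this
      exact this
    have hintT : IntegrableOn (fun x : ℝ => x ^ n * deriv Φ x * gT (ε * x)) (Ioi 0) := by
      have := integrableOn_pow_mul_mul_shellFunction hΦ'c hΦ'supp hITc (m + 1) hε
      rw [← hnm] at this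
      exact this
    have hsplit : ∫ x in Ioi (0 : ℝ), x ^ n * deriv Φ x * ((ε * x)⁻¹ * energyFluxShellPairing T u ψ (ε * x)) =
        (∫ x in Ioi (0 : ℝ), x ^ n * deriv Φ x * gL (ε * x)) +
          ∫ x in Ioi (0 : ℝ), x ^ n * deriv Φ x * gT (ε * x) := by
      rw [← integral_add hintL hintT]
      refine setIntegral_congr_fun measurableSet_Ioi fun x _ => ?_
      rw [hsum x, mul_add]
    rw [e1, e2L, e2T, hsplit]
    simp only [eyinkLongitudinalConst, eyinkTransverseConst, ← hndef]
    have hm1 : (n : ℝ) - 1 ≠ 0 := by rw [hnR]; have : (0:ℝ) ≤ m := Nat.cast_nonneg m; linarith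
    field_simp
    ring
  -- the limits
  have hLT := h.tendsto hφ hψ
  have hlim := (hLT.1.const_mul (n : ℝ)⁻¹).add (hLT.2.const_mul (((n : ℝ) - 1) / n))
  have hval : (n : ℝ)⁻¹ * D ψ + ((n : ℝ) - 1) / n * D ψ = D ψ := by
    field_simp
    ring
  rw [hval] at hlim
  refine hlim.congr' ?_
  filter_upwards [self_mem_nhdsWithin] with ε hε using (hid ε hε).symm

/-- **A uniform Eyink defect is the Duchon–Robert defect**: if `u ∈ L³` (jointly measurable,
`d ≥ 2`) has Duchon–Robert defect `D` (`Torus.HasDuchonRobertDefect T u D`) and a uniform Eyink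
defect `D'`, then `D' ψ = D ψ` for every test function supported in `(0,T) × T^d` (both are the
limit of the Duchon–Robert pairings of a radial unit-ball mollifier, `exists_isMollifier_radial`;
Duchon–Robert 2000, Prop. 2: the defect is independent of `φ`). [folklore] -/
theorem HasUniformEyinkDefect.eq_of_hasDuchonRobertDefect (hU : HasUniformEyinkDefect T u D')
    (h : HasDuchonRobertDefect T u D) (hn2 : 2 ≤ Fintype.card d)
    (hum : AEStronglyMeasurable (FunctionSpaces.Torus.stLift u) (volume.restrict (Ioo 0 T ×ˢ univ)))
    (hu3 : ∫⁻ t in Ioo 0 T, ∫⁻ x, ‖u t x‖ₑ ^ (3 : ℕ) < ∞)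
    (hψ : FunctionSpaces.Torus.IsSpaceTimeTestIoo T ψ) :
    D' ψ = D ψ := by
  haveI : Nonempty d := by
    by_contra hd
    rw [not_nonempty_iff] at hd
    have : Fintype.card d = 0 := Fintype.card_eq_zero
    omega
  obtain ⟨φ, hφ, hrad, hsupp⟩ := exists_isMollifier_radial (d := d)
  exact tendsto_nhds_unique (hU.tendsto_duchonRobertApprox hn2 hum hu3 ⟨⟨hφ, hsupp⟩, hrad⟩ hψ)
    (h φ hφ ψ hψ)

/-- A uniform Eyink defect of a field with a Duchon–Robert defect `D` may be replaced by `D`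
itself: `D` is then a uniform Eyink defect. [folklore] -/
theorem HasDuchonRobertDefect.hasUniformEyinkDefect (h : HasDuchonRobertDefect T u D)
    (hU : HasUniformEyinkDefect T u D') (hn2 : 2 ≤ Fintype.card d)
    (hum : AEStronglyMeasurable (FunctionSpaces.Torus.stLift u) (volume.restrict (Ioo 0 T ×ˢ univ)))
    (hu3 : ∫⁻ t in Ioo 0 T, ∫⁻ x, ‖u t x‖ₑ ^ (3 : ℕ) < ∞) :
    HasUniformEyinkDefect T u D :=
  hU.congr_defect fun _ hψ => hU.eq_of_hasDuchonRobertDefect h hn2 hum hu3 hψ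

end Consistency

/-! ## The reduction of the accepted 4/5-law fact -/

section Reduction

variable {T : ℝ} {u : ℝ → UnitAddTorus d → EuclideanSpace ℝ d} {D D' : STFunctional d}

/-- Two defects that agree on test functions supported in `(0,T)` have the same 4/5 law (cf.
`Torus.HasFourThirdsLaw.congr_defect`). [folklore] -/
theorem HasFourFifthsLaw.congr_defect (h : HasFourFifthsLaw T u D)
    (hDD' : ∀ ψ : ℝ → UnitAddTorus d → ℝ, FunctionSpaces.Torus.IsSpaceTimeTestIoo T ψ → D ψ = D' ψ) :
    HasFourFifthsLaw T u D' := by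
  intro ψ hψ
  rw [← hDD' ψ hψ]
  exact h ψ hψ

/-- **The 4/5 law for a field with some uniform Eyink defect**: if `u ∈ L³` (jointly measurable,
`d ≥ 2`) has Duchon–Robert defect `D` and *a* uniform Eyink defect `D'`, then the local 4/5 law
holds with `D` (`HasUniformEyinkDefect.hasFourFifthsLaw` for `D'`, and `D' = D` on test functions,
`HasUniformEyinkDefect.eq_of_hasDuchonRobertDefect`). [folklore] -/
theorem HasDuchonRobertDefect.hasFourFifthsLaw_of_hasUniformEyinkDefect
    (h : HasDuchonRobertDefect T u D) (hU : HasUniformEyinkDefect T u D') (hn2 : 2 ≤ Fintype.card d)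
    (hum : AEStronglyMeasurable (FunctionSpaces.Torus.stLift u) (volume.restrict (Ioo 0 T ×ˢ univ)))
    (hu3 : ∫⁻ t in Ioo 0 T, ∫⁻ x, ‖u t x‖ₑ ^ (3 : ℕ) < ∞) :
    HasFourFifthsLaw T u D :=
  (hU.hasFourFifthsLaw hn2 hum hu3).congr_defect fun _ hψ => hU.eq_of_hasDuchonRobertDefect h hn2 hum hu3 hψ

/-- The companion 8/15-type law with the Duchon–Robert defect `D` in the limit:
`∫₀ᵀ∫ ℓ⁻¹ ⟨δu_L|δu_T|²⟩_{ang}(ℓ) ψ → −(4(d−1)/(d(d+2))) D ψ`. [folklore] -/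
theorem HasDuchonRobertDefect.tendsto_mixedFlux_of_hasUniformEyinkDefect
    (h : HasDuchonRobertDefect T u D) (hU : HasUniformEyinkDefect T u D') (hn2 : 2 ≤ Fintype.card d)
    (hum : AEStronglyMeasurable (FunctionSpaces.Torus.stLift u) (volume.restrict (Ioo 0 T ×ˢ univ)))
    (hu3 : ∫⁻ t in Ioo 0 T, ∫⁻ x, ‖u t x‖ₑ ^ (3 : ℕ) < ∞)
    {ψ : ℝ → UnitAddTorus d → ℝ} (hψ : FunctionSpaces.Torus.IsSpaceTimeTestIoo T ψ) :
    Tendsto (fun ℓ => ∫ t in Ioo 0 T, ∫ x, ℓ⁻¹ * mixedFluxSphereAvg (u t) ℓ x * ψ t x) (𝓝[>] 0)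
      (𝓝 (-(4 * ((Fintype.card d : ℝ) - 1) /
        ((Fintype.card d : ℝ) * ((Fintype.card d : ℝ) + 2))) * D ψ)) := by
  rw [← hU.eq_of_hasDuchonRobertDefect h hn2 hum hu3 hψ]
  exact hU.tendsto_mixedFlux hn2 hum hu3 hψ

/-- **Reduction of the accepted fact `HasDuchonRobertDefect.hasFourFifthsLaw` in dimension
`d ≥ 2`.** The accepted (unconditional) local 4/5 law for `L³` weak Euler solutions follows as soon
as every such solution with a Duchon–Robert defect admits *some* uniform Eyink defect — the
uniformity in the mollifier that the proof of Eyink 2003, Thm. 1 provides through the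
longitudinal/transverse balance identities at scale `ε` (with the `L^{3/2}` pressure of
`Torus.exists_pressure_of_tendsto_L3`). This is the remaining, Euler-dependent input. [folklore] -/
theorem hasFourFifthsLaw_of_forall_hasUniformEyinkDefect (hn2 : 2 ≤ Fintype.card d)
    (hunif : ∀ [DecidableEq d] {D : STFunctional d}, HasDuchonRobertDefect T u D →
      FunctionSpaces.Torus.IsWeakEulerSolutionOn T u →
      (∫⁻ t in Ioo 0 T, ∫⁻ x, ‖u t x‖ₑ ^ (3 : ℕ) < ∞) →
      ∃ D' : STFunctional d, HasUniformEyinkDefect T u D') :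
    HasDuchonRobertDefect.hasFourFifthsLaw (T := T) (u := u) := by
  intro _ D h hE hu3
  obtain ⟨D', hD'⟩ := hunif h hE hu3
  exact h.hasFourFifthsLaw_of_hasUniformEyinkDefect hD' hn2 hE.1 hu3

end Reduction

/-! ## The printed constants in `d = 3` -/

section DimThree

/-- In `d = 3` a uniform Eyink defect yields the printed laws of Eyink 2003, Cor. 1 — now with the
existence of the limits as a conclusion: `S_L(u,ℓ) → −(4/5) D`, `S_T(u,ℓ) → −(8/15) D` in
`𝒟'((0,T) × T³)`. [cite: Eyink2003, §2 Cor. 1] -/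
theorem HasUniformEyinkDefect.tendsto_fin_three {T : ℝ}
    {u : ℝ → UnitAddTorus (Fin 3) → EuclideanSpace ℝ (Fin 3)} {D : STFunctional (Fin 3)}
    (h : HasUniformEyinkDefect T u D)
    (hum : AEStronglyMeasurable (FunctionSpaces.Torus.stLift u) (volume.restrict (Ioo 0 T ×ˢ univ)))
    (hu3 : ∫⁻ t in Ioo 0 T, ∫⁻ x, ‖u t x‖ₑ ^ (3 : ℕ) < ∞)
    {ψ : ℝ → UnitAddTorus (Fin 3) → ℝ} (hψ : FunctionSpaces.Torus.IsSpaceTimeTestIoo T ψ) :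
    Tendsto (fun ℓ => ∫ t in Ioo 0 T, ∫ x, ℓ⁻¹ * longitudinalFluxSphereAvg (u t) ℓ x * ψ t x) (𝓝[>] 0)
        (𝓝 (-(4 / 5) * D ψ)) ∧
      Tendsto (fun ℓ => ∫ t in Ioo 0 T, ∫ x, ℓ⁻¹ * mixedFluxSphereAvg (u t) ℓ x * ψ t x) (𝓝[>] 0)
        (𝓝 (-(8 / 15) * D ψ)) := by
  have h3 : 2 ≤ Fintype.card (Fin 3) := by simp
  refine ⟨?_, ?_⟩
  · have := h.hasFourFifthsLaw h3 hum hu3 ψ hψ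
    rwa [fourFifthsConst_fin_three] at this
  · have := h.tendsto_mixedFlux h3 hum hu3 hψ
    have h815 : -(4 * ((Fintype.card (Fin 3) : ℝ) - 1) /
        (Fintype.card (Fin 3) * ((Fintype.card (Fin 3) : ℝ) + 2))) = -(8 / 15 : ℝ) := by
      norm_num [Fintype.card_fin]
    rwa [h815] at this

end DimThree

end Literature.Analysis.FluidPDE.Torus
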